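import Literature.NumberTheory.Sieve.MoebiusShiftedPrimesDirichletMeanValue
import HarnessLib

/-!
# Möbius on shifted primes — Proposition 5.1 of Lichtman 2020 at the printed first exponent, saving `(log X)^{-3A}`

Topic `Literature/NumberTheory/Sieve`, part of the decomposition of the named fact
`Literature.NumberTheory.Sieve.Lichtman2020_keyFourierEstimateLiouville` (J. D. Lichtman, *Averages of
the Möbius function on shifted primes*, Q. J. Math. 73 (2022) 729–757, arXiv:2009.08969v2
[Lichtman2020], Proposition 2.3 AS PRINTED: typical set `S = lichtmanTypical` with first interval
`[P₁, Q₁] = [(log X)^{33A}, H/(log X)^{4A}]`, and the printed hypothesis `ψ(X) ≤ (log X)^{2/3}`,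
`H = (log X)^{ψ(X)}`).  Page numbers refer to the held copy `paper:arxiv-2009.08969`.

`MoebiusShiftedPrimesTypical.lean` documents the gap in the printed proof of Proposition 5.1 (p. 15,
"Bound for `E₁`": `V/(1 - e^{-2α/V}) ≍ V²/(2α)`, not `O(1)`) and repairs it by enlarging `P₁` to
`(log X)^{cA}`, `c ≥ 100`, keeping the printed saving `(log X)^{-B}`, `B = 11A`.  This file keeps the
PRINTED `P₁` (any `c ≥ 33`) and instead lowers the saving to `B = 3A`, which the honest bookkeeping
affords: with `V = (log X)^{3A}`, `α = 3/20`, the `E₁` factor is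
`≍ V² P₁^{-2α} log X = (log X)^{6A + 1 - (3/10)cA} ≤ 30 (log X)^{-3A}` as soon as `(3/10)c ≥ 9 + 1/A`,
true for `c ≥ 33`, `A ≥ 10/9`; and the count (5.10) of the bad unit intervals is
`≪ T^{2α + 1/2 + 16 log log T/log P₁ + o(1)} = T^{9/10 + o(1)} ≤ Y/Q₂`.  The saving `(log X)^{-3A}`
suffices for Proposition 2.3 as printed (which asks for `d^{-3/4} W^{-1/5}` only) once the major arcs
are treated by sub-windows of length `≍ W^{-1/5}/|θ|` instead of Abel summation — the files
`MoebiusShiftedPrimesMeanSquare33.lean`, `…MajorArcs33.lean` built on this one.  Everything here is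
PROVED; the only named fact used is Lemma 4.5 (`Lichtman2020_primeCharacterSum`, the
Vinogradov–Korobov input, itself reduced to `Khale2024_zeroFreeRegion` in the tree).

* `Lichtman2020.dirichletMeanValue33` — PROVED from `Lichtman2020_primeCharacterSum`: for `c ≥ 33`,
  `A > 5`, `δ > 0`, `ψ → ∞`, `ψ(X) ≤ (log X)^{2/3}` (the printed hypothesis, literally), eventually in
  `X`, for `q ≤ (log X)^A`, `χ (mod q)`, `Y ∈ [X/(log X)^{6A}, 2X]`, `T ∈ [0, 2X]`:
  `∫_{(log X)^{6A}}^{T} |∑_{Y ≤ n ≤ 2Y, n ∈ S_c} λ(n)χ(n) n^{-1-it}|² dt ≤ C (Q₁T/Y + 1)/(log X)^{3A}`.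

## The argument

Verbatim the tree's proof of Proposition 5.1 along `S_c` (`Lichtman2020.dirichletMeanValue_strong`,
`MoebiusShiftedPrimesDirichletMeanValue.lean`: the generic fixed-parameter inequality
`prop51_fixed`, Lemma 4.7 = MR Lemma 12, Lemma 4.3 = MR Lemma 9, Lemma 4.1, Lemma 4.4 = MR Lemma 8
with explicit exponent `16`), with the parameters `B = 3A`, `V = L^{3A}`, `T₀ = L^{6A}`, `α = 3/20`,
`K = 6A` in Lemma 4.5 (`L = log X`), and three changes of bookkeeping:
* `E1_factor_numerics33`: `V log(Q₁/P₁) e^{2α/V} P₁^{-2α}(1 + V/2α) ≤ 30 L^{-3A}` for `c ≥ 33`;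
* `cardB_bound33` ((5.10)): `#bad √T' ≤ 2304 V L e^{(3/10)L^{3/4}} (3X)^{9/10} ≤ Y/Q₂`, using
  `v₀ ≥ V(cA log L - 1)`, `log log T' ≤ log L + 1/128` (not the factor-4 loss of the tree's
  `cardB_bound`), whence `16 V log log T'/v₀ ≤ 1/10` for `cA ≥ 165`;
* the regime: from `ψ(X) ≤ L^{2/3}` literally, `H ≤ exp(L^{2/3} log L) ≤ exp(L^{3/4})` and
  `Q₁ ≤ H < P₂ = exp(L^{2/3+δ/2})` eventually (`eventually_H_le_exp_of_psi`); all uses of the tree's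
  standing assumption `H ≤ exp(L^{2/3})` go through `H ≤ exp(L^{3/4})` except `Q₁ < P₂`.

## Faithfulness notes

* This is Proposition 5.1 (p. 14) with the printed `P₁ = (log X)^{33A}` (indeed any `c ≥ 33`) and the
  printed hypothesis on `ψ`, but with `B = 3A` in place of the printed `B = 11A` (lower limit
  `(log X)^{2B} = (log X)^{6A}`, saving `(log X)^{-B}`), which is what the printed method yields at the
  printed `P₁` (module docstring of `MoebiusShiftedPrimesTypical.lean`: any `B < 5.5A - 1`); the
  ranges `Y ∈ [X/(log X)^{6A}, 2X]`, `T ∈ [0, 2X]` and the cut-off-free `S_d` are those of the tree's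
  `Lichtman2020_dirichletMeanValueWith`.
* No new definition and no named fact is introduced.

## Sources

* J. D. Lichtman, arXiv:2009.08969v2, Proposition 5.1 and §5.1, (5.7)–(5.10), pp. 14–15
  [Lichtman2020].
* K. Matomäki, M. Radziwiłł, Ann. of Math. (2) 183 (2016), Lemmas 8, 9, 12, §8
  [MatomakiRadziwillAnnals2016].
-/

noncomputable section

open Finset Real Complex MeasureTheory Filter
open scoped Topology


namespace Literature.NumberTheory.Sieve.Lichtman2020

/-! ### The printed regime `ψ(X) ≤ (log X)^{2/3}` -/

/-- From the printed hypothesis `ψ(X) = log H/log log X ≤ (log X)^{2/3}`: for every `e > 2/3`,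
eventually `H ≤ exp((log X)^e)` (as `log H ≤ (log X)^{2/3} log log X` and `log log X ≤ (log X)^{e-2/3}`).
[cite: Lichtman2020, Proposition 2.3] -/
theorem eventually_H_le_exp_of_psi {H : ℕ → ℕ}
    (hψ : ∀ᶠ X : ℕ in atTop, Real.log (H X) / Real.log (Real.log X) ≤ Real.log X ^ (2 / 3 : ℝ))
    {e : ℝ} (he : 2 / 3 < e) :
    ∀ᶠ X : ℕ in atTop, (H X : ℝ) ≤ Real.exp (Real.log X ^ e) := by
  filter_upwards [hψ, eventually_loglog_le_natCast (e - 2 / 3) 1 (by linarith) one_pos,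
    (Real.tendsto_log_atTop.comp tendsto_log_natCast).eventually_gt_atTop 0,
    tendsto_log_natCast.eventually_gt_atTop 0] with X hX hll hll0 hl0
  rcases Nat.eq_zero_or_pos (H X) with h0 | hpos
  · rw [h0]; push_cast; exact (Real.exp_pos _).le
  have hH0 : (0 : ℝ) < H X := by exact_mod_cast hpos
  have h1 : Real.log (H X) ≤ Real.log X ^ (2 / 3 : ℝ) * Real.log (Real.log X) :=
    (div_le_iff₀ hll0).mp hX
  have h2 : Real.log X ^ (2 / 3 : ℝ) * Real.log (Real.log X) ≤ Real.log X ^ e := by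
    rw [one_mul] at hll
    calc Real.log X ^ (2 / 3 : ℝ) * Real.log (Real.log X)
        ≤ Real.log X ^ (2 / 3 : ℝ) * Real.log X ^ (e - 2 / 3) :=
          mul_le_mul_of_nonneg_left hll (Real.rpow_nonneg hl0.le _)
      _ = Real.log X ^ e := by rw [← Real.rpow_add hl0]; ring_nf
  calc (H X : ℝ) = Real.exp (Real.log (H X)) := (Real.exp_log hH0).symm
    _ ≤ Real.exp (Real.log X ^ e) := Real.exp_le_exp.mpr (h1.trans h2)

/-- In the printed regime, eventually `H < P₂ = exp((log X)^{2/3+δ/2})` (`δ > 0`), so `Q₁ ≤ H < P₂`: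
the two intervals `[P₁,Q₁]`, `[P₂,Q₂]` are disjoint. [cite: Lichtman2020, §2, p. 8] -/
theorem eventually_H_lt_P2_of_psi {H : ℕ → ℕ}
    (hψ : ∀ᶠ X : ℕ in atTop, Real.log (H X) / Real.log (Real.log X) ≤ Real.log X ^ (2 / 3 : ℝ))
    {δ : ℝ} (hδ : 0 < δ) :
    ∀ᶠ X : ℕ in atTop, (H X : ℝ) < Real.exp (Real.log X ^ (2 / 3 + δ / 2)) := by
  filter_upwards [eventually_H_le_exp_of_psi hψ (e := 2 / 3 + δ / 4) (by linarith),
    tendsto_log_natCast.eventually_gt_atTop 1] with X hX hl1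
  refine lt_of_le_of_lt hX ?_
  rw [Real.exp_lt_exp]
  exact Real.rpow_lt_rpow_of_exponent_lt hl1 (by linarith)

/-! ### The bound `U` for `Q_{v,2}` from Lemma 4.5 (at scale `X²`), general lower limit -/

/-- **(5.9) with a general lower limit**: on the unit intervals above `T₀ = L^{B₀}` (`L = log X`,
`B₀ ≥ 0`), `|Q_{v,2}(1+it)| ≤ 3 C₄₅⁺ L^{1-B₀}`, by Lemma 4.5 at scale `X' = X²` with `K = B₀`
(`t ≤ 2X + 1 ≤ X²`, `q ≤ L^A ≤ (2L)^A`, `P₂ ≥ exp((2L)^θ)`). [cite: Lichtman2020, (5.9)] -/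
theorem UQ_bound' {C₄₅ A θ B₀ : ℝ} {X : ℕ}
    (h45 : ∀ q : ℕ, 1 ≤ q → (q : ℝ) ≤ Real.log ((X : ℝ) ^ 2) ^ A → ∀ χ : DirichletCharacter ℂ q,
      ∀ P Q : ℝ, Real.exp (Real.log ((X : ℝ) ^ 2) ^ θ) ≤ P → P ≤ Q → Q ≤ (X : ℝ) ^ 2 → ∀ t : ℝ, |t| ≤ (X : ℝ) ^ 2 →
        ‖∑ p ∈ (Icc ⌈P⌉₊ ⌊Q⌋₊).filter Nat.Prime, χ (p : ZMod q) * (p : ℂ) ^ (-(1 + (t : ℂ) * I))‖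
          ≤ C₄₅ * (Real.log ((X : ℝ) ^ 2) / (1 + |t|) + Real.log ((X : ℝ) ^ 2) ^ (-B₀)))
    (hL : 64 ≤ Real.log X) (hA : 0 < A) (hB₀ : 0 ≤ B₀) {q : ℕ} (hq : 1 ≤ q)
    (hqA : (q : ℝ) ≤ Real.log X ^ A)
    (χ : DirichletCharacter ℂ q) {P₂ Q₂ V T : ℝ}
    (hP₂ : Real.exp ((2 * Real.log X) ^ θ) ≤ P₂) (hQ₂ : Q₂ ≤ X) (hT : T ≤ 2 * X)
    (v : ℕ) {n : ℕ} (hn : n ∈ Finset.Ico ⌊Real.log X ^ B₀⌋₊ (⌊T⌋₊ + 1))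
    {t : ℝ} (ht : t ∈ Set.Icc (n : ℝ) (n + 1)) :
    ‖blockPrimePoly (lamChi χ) P₂ Q₂ V v t‖ ≤ 3 * max C₄₅ 0 * Real.log X ^ (1 - B₀) := by
  obtain ⟨hX3, hX0⟩ := X_large hL
  set L := Real.log X with hLdef
  have hL1 : 1 ≤ L := by linarith
  have hL0 : 0 < L := by linarith
  have hlog2 : Real.log ((X : ℝ) ^ 2) = 2 * L := by rw [Real.log_pow]; push_cast; ring
  have hX'1 : (1 : ℝ) ≤ (X : ℝ) ^ 2 := by nlinarith
  -- `t`
  obtain ⟨ht1, ht2⟩ := ht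
  rw [Finset.mem_Ico] at hn
  have hn0 : (0 : ℝ) ≤ n := Nat.cast_nonneg n
  have htT : t ≤ 2 * X + 1 := by
    have h1 : (n : ℝ) ≤ ⌊T⌋₊ := by exact_mod_cast (show n ≤ ⌊T⌋₊ by omega)
    have h2 : (⌊T⌋₊ : ℝ) ≤ 2 * X := by
      rcases le_or_gt 0 T with h | h
      · exact (Nat.floor_le h).trans hT
      · rw [Nat.floor_of_nonpos h.le]; push_cast; positivity
    linarith
  have htabs : |t| = t := abs_of_nonneg (by linarith)
  have htX : |t| ≤ (X : ℝ) ^ 2 := by rw [htabs]; nlinarith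
  have htT₀ : L ^ B₀ ≤ 1 + |t| := by
    rw [htabs]
    have h1 : (⌊L ^ B₀⌋₊ : ℝ) ≤ n := by exact_mod_cast hn.1
    have h2 : L ^ B₀ < ⌊L ^ B₀⌋₊ + 1 := Nat.lt_floor_add_one _
    linarith
  -- Lemma 4.5 at scale X²
  have hqA' : (q : ℝ) ≤ Real.log ((X : ℝ) ^ 2) ^ A := by
    rw [hlog2]
    exact hqA.trans (Real.rpow_le_rpow hL0.le (by linarith) hA.le)
  have hP₂' : Real.exp (Real.log ((X : ℝ) ^ 2) ^ θ) ≤ P₂ := by rwa [hlog2]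
  have hQ₂' : Q₂ ≤ (X : ℝ) ^ 2 := hQ₂.trans (by nlinarith)
  have key := norm_blockPrimePoly_le_of_L45 (K := B₀) h45 hX'1 hq hqA' χ hP₂' hQ₂' (H := V) v htX
  refine key.trans ?_
  rw [hlog2]
  have hD : 0 ≤ max C₄₅ 0 := le_max_right _ _
  have hpow0 : 0 < L ^ B₀ := Real.rpow_pos_of_pos hL0 _
  -- `2L/(1+|t|) ≤ 2 L^{1-B₀}` and `(2L)^{-B₀} ≤ L^{1-B₀}`
  have e1 : L ^ (1 - B₀) = L / L ^ B₀ := by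
    rw [Real.rpow_sub hL0, Real.rpow_one]
  have h1 : 2 * L / (1 + |t|) ≤ 2 * L ^ (1 - B₀) := by
    rw [e1, mul_div_assoc]
    refine mul_le_mul_of_nonneg_left ?_ (by norm_num)
    exact div_le_div_of_nonneg_left hL0.le hpow0 htT₀
  have h2 : (2 * L) ^ (-B₀) ≤ L ^ (1 - B₀) := by
    have h3 : (2 * L) ^ (-B₀) ≤ L ^ (-B₀) :=
      Real.rpow_le_rpow_of_nonpos hL0 (by linarith) (by linarith)
    refine h3.trans ?_
    rw [Real.rpow_neg hL0.le, e1, le_div_iff₀ hpow0, inv_mul_cancel₀ hpow0.ne']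
    exact hL1
  calc max C₄₅ 0 * (2 * L / (1 + |t|) + (2 * L) ^ (-B₀))
      ≤ max C₄₅ 0 * (2 * L ^ (1 - B₀) + L ^ (1 - B₀)) := by gcongr
    _ = 3 * max C₄₅ 0 * L ^ (1 - B₀) := by ring

/-! ### Numerics of the factors with `V = L^{3A}`, `α = 3/20`, `K = 6A` -/

/-- The `E₁` factor at the printed first exponent: `V log(Q₁/P₁) e^{2α/V} P₁^{-2α} (1 + V/2α) ≤ 30 L^{-3A}`
for `V = L^{3A}`, `α = 3/20`, `P₁ = L^{cA}`, `c ≥ 33`, `A ≥ 2`, `log Q₁ ≤ L` — the honest form of the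
bound for `E₁` (p. 15) with the factor `V/(1 - e^{-2α/V}) ≍ V²/(2α)` kept:
`30 L^{6A + 1 - (3/10)cA} ≤ 30 L^{-3A}`. [cite: Lichtman2020, §5.1, bound for E₁] -/
theorem E1_factor_numerics33 {V L P₁ Q₁ c A : ℝ} (hL1 : 1 ≤ L) (hA : 2 ≤ A) (hc : 33 ≤ c)
    (hV : V = L ^ (3 * A)) (hP₁ : P₁ = L ^ (c * A)) (hPQ : P₁ ≤ Q₁) (hlogQ₁ : Real.log Q₁ ≤ L) :
    (V * Real.log (Q₁ / P₁)) *
        (Real.exp (2 * (3 / 20 : ℝ) / V) * P₁ ^ (-(2 * (3 / 20 : ℝ))) * (1 + V / (2 * (3 / 20 : ℝ)))) ≤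
      30 * L ^ (-(3 * A)) := by
  have hL0 : 0 < L := by linarith
  have hA0 : 0 < A := by linarith
  have hV1 : 1 ≤ V := by rw [hV]; exact Real.one_le_rpow hL1 (by positivity)
  have hV0 : 0 < V := by linarith
  have hP₁1 : 1 ≤ P₁ := by rw [hP₁]; exact Real.one_le_rpow hL1 (by nlinarith)
  have hP₁0 : 0 < P₁ := by linarith
  have hQ₁0 : 0 < Q₁ := by linarith
  have hlog : Real.log (Q₁ / P₁) ≤ L := by
    rw [Real.log_div hQ₁0.ne' hP₁0.ne']
    linarith [Real.log_nonneg hP₁1]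
  have hlog0 : 0 ≤ Real.log (Q₁ / P₁) := Real.log_nonneg (by rw [le_div_iff₀ hP₁0]; linarith)
  have ha : V * Real.log (Q₁ / P₁) ≤ 2 * V * L := by
    have : V * Real.log (Q₁ / P₁) ≤ V * L := mul_le_mul_of_nonneg_left hlog hV0.le
    nlinarith
  have hb : Real.exp (2 * (3 / 20 : ℝ) / V) ≤ 3 := by
    have h2 : 2 * (3 / 20 : ℝ) / V ≤ 1 := by rw [div_le_one hV0]; linarith
    have := Real.exp_one_lt_d9
    linarith [Real.exp_le_exp.mpr h2]
  have hcexp : P₁ ^ (-(2 * (3 / 20 : ℝ))) = L ^ (-(3 / 10 * (c * A))) := by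
    rw [hP₁, ← Real.rpow_mul hL0.le]; congr 1; ring
  have hd : 1 + V / (2 * (3 / 20 : ℝ)) ≤ 5 * V := by
    have : V / (2 * (3 / 20 : ℝ)) = 10 / 3 * V := by ring
    linarith
  have hL3 : 0 ≤ L ^ (-(3 / 10 * (c * A))) := Real.rpow_nonneg hL0.le _
  have hVVL : V * V * L = L ^ (6 * A + 1) := by
    rw [hV, ← Real.rpow_add hL0, ← Real.rpow_add_one hL0.ne']; congr 1; ring
  calc (V * Real.log (Q₁ / P₁)) *
        (Real.exp (2 * (3 / 20 : ℝ) / V) * P₁ ^ (-(2 * (3 / 20 : ℝ))) * (1 + V / (2 * (3 / 20 : ℝ))))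
      ≤ (2 * V * L) * (3 * L ^ (-(3 / 10 * (c * A))) * (5 * V)) := by
        rw [hcexp]
        refine mul_le_mul ha ?_ (by positivity) (by positivity)
        exact mul_le_mul (mul_le_mul_of_nonneg_right hb hL3) hd (by positivity) (by positivity)
    _ = 30 * (V * V * L) * L ^ (-(3 / 10 * (c * A))) := by ring
    _ = 30 * L ^ (6 * A + 1 + (-(3 / 10 * (c * A)))) := by
        rw [hVVL, mul_assoc, ← Real.rpow_add hL0]
    _ ≤ 30 * L ^ (-(3 * A)) := by
        refine mul_le_mul_of_nonneg_left (Real.rpow_le_rpow_of_exponent_le hL1 ?_) (by norm_num)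
        nlinarith

/-- The `E₂` factor: `V log(Q₂/P₂) #ℐ₂ · 10 C₉ U² log(2T') ≤ 720 C₉ D² L^{-3A}` for `V = L^{3A}`,
`P₂ = exp(L^{2/3+δ/2}) ≤ Q₂ = exp(L^{1-δ/2})`, `U = 3D L^{1-6A}`, `log(2T') ≤ 2L`, `A ≥ 2`
(`720 C₉ D² L^{5 - 6A} ≤ 720 C₉ D² L^{-3A}`). [cite: Lichtman2020, §5.1, bound for E₂] -/
theorem E2_factor_numerics33 {V L P₂ Q₂ δ A D C₉ T' : ℝ} (hL1 : 1 ≤ L) (hA : 2 ≤ A) (hδ : 0 < δ)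
    (hC₉ : 0 ≤ C₉) (hV : V = L ^ (3 * A))
    (hP₂ : P₂ = Real.exp (L ^ (2 / 3 + δ / 2))) (hQ₂ : Q₂ = Real.exp (L ^ (1 - δ / 2)))
    (hPQ₂ : P₂ ≤ Q₂) (hT'1 : 1 ≤ T') (hlog2T' : Real.log (2 * T') ≤ 2 * L) :
    (V * Real.log (Q₂ / P₂)) * ((#(Icc ⌊V * Real.log P₂⌋₊ ⌊V * Real.log Q₂⌋₊) : ℝ) *
        (10 * C₉ * (3 * D * L ^ (1 - 6 * A)) ^ 2 * Real.log (2 * T'))) ≤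
      720 * C₉ * D ^ 2 * L ^ (-(3 * A)) := by
  have hL0 : 0 < L := by linarith
  have hA0 : 0 < A := by linarith
  have hV1 : 1 ≤ V := by rw [hV]; exact Real.one_le_rpow hL1 (by positivity)
  have hV0 : 0 < V := by linarith
  have hP₂0 : 0 < P₂ := by rw [hP₂]; exact Real.exp_pos _
  have hQ₂0 : 0 < Q₂ := by rw [hQ₂]; exact Real.exp_pos _
  have hQ₂1 : 1 ≤ Q₂ := by rw [hQ₂]; exact Real.one_le_exp (Real.rpow_nonneg hL0.le _)
  have hlogQ₂ : Real.log Q₂ = L ^ (1 - δ / 2) := by rw [hQ₂, Real.log_exp]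
  have hlogP₂ : Real.log P₂ = L ^ (2 / 3 + δ / 2) := by rw [hP₂, Real.log_exp]
  have hL1δ : L ^ (1 - δ / 2) ≤ L := by
    calc L ^ (1 - δ / 2) ≤ L ^ (1 : ℝ) := Real.rpow_le_rpow_of_exponent_le hL1 (by linarith)
      _ = L := Real.rpow_one L
  have ha : V * Real.log (Q₂ / P₂) ≤ 2 * V * L := by
    rw [Real.log_div hQ₂0.ne' hP₂0.ne', hlogQ₂, hlogP₂]
    have : 0 ≤ L ^ (2 / 3 + δ / 2) := Real.rpow_nonneg hL0.le _
    have : V * (L ^ (1 - δ / 2) - L ^ (2 / 3 + δ / 2)) ≤ V * L := by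
      apply mul_le_mul_of_nonneg_left _ hV0.le; linarith
    nlinarith
  have hb : (#(Icc ⌊V * Real.log P₂⌋₊ ⌊V * Real.log Q₂⌋₊) : ℝ) ≤ 2 * V * L := by
    rw [Nat.card_Icc]
    have h1' : ((⌊V * Real.log Q₂⌋₊ + 1 - ⌊V * Real.log P₂⌋₊ : ℕ) : ℝ) ≤ ⌊V * Real.log Q₂⌋₊ + 1 := by
      exact_mod_cast Nat.sub_le _ _
    refine h1'.trans ?_
    have h2' : (⌊V * Real.log Q₂⌋₊ : ℝ) ≤ V * Real.log Q₂ :=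
      Nat.floor_le (mul_nonneg hV0.le (Real.log_nonneg hQ₂1))
    have h3' : V * Real.log Q₂ ≤ V * L := by
      rw [hlogQ₂]; exact mul_le_mul_of_nonneg_left hL1δ hV0.le
    have h4' : 1 ≤ V * L := by nlinarith
    linarith
  have hlog0 : 0 ≤ Real.log (2 * T') := Real.log_nonneg (by linarith)
  have hU2 : (3 * D * L ^ (1 - 6 * A)) ^ 2 = 9 * D ^ 2 * L ^ (2 - 12 * A) := by
    have : (L ^ (1 - 6 * A)) ^ 2 = L ^ (2 - 12 * A) := by
      rw [← Real.rpow_natCast _ 2, ← Real.rpow_mul hL0.le]; congr 1; push_cast; ring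
    rw [mul_pow, mul_pow, this]; ring
  have hLpow0 : 0 ≤ L ^ (2 - 12 * A) := Real.rpow_nonneg hL0.le _
  have hlogd0 : 0 ≤ Real.log (Q₂ / P₂) := Real.log_nonneg (by rw [le_div_iff₀ hP₂0]; linarith)
  have hVVL : V * V * L = L ^ (6 * A + 1) := by
    rw [hV, ← Real.rpow_add hL0, ← Real.rpow_add_one hL0.ne']; congr 1; ring
  have hLL : L * L = L ^ (2 : ℝ) := by rw [Real.rpow_two, sq]
  calc (V * Real.log (Q₂ / P₂)) * ((#(Icc ⌊V * Real.log P₂⌋₊ ⌊V * Real.log Q₂⌋₊) : ℝ) *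
        (10 * C₉ * (3 * D * L ^ (1 - 6 * A)) ^ 2 * Real.log (2 * T')))
      ≤ (2 * V * L) * ((2 * V * L) * (10 * C₉ * (9 * D ^ 2 * L ^ (2 - 12 * A)) * (2 * L))) := by
        rw [hU2]
        refine mul_le_mul ha ?_ (by positivity) (by positivity)
        refine mul_le_mul hb ?_ (by positivity) (by positivity)
        exact mul_le_mul_of_nonneg_left hlog2T' (by positivity)
    _ = 720 * C₉ * D ^ 2 * ((V * V * L) * (L * L) * L ^ (2 - 12 * A)) := by ring
    _ = 720 * C₉ * D ^ 2 * L ^ (6 * A + 1 + 2 + (2 - 12 * A)) := by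
        rw [hVVL, hLL, ← Real.rpow_add hL0, ← Real.rpow_add hL0]
    _ ≤ 720 * C₉ * D ^ 2 * L ^ (-(3 * A)) := by
        refine mul_le_mul_of_nonneg_left (Real.rpow_le_rpow_of_exponent_le hL1 ?_) (by positivity)
        linarith

/-- The final real arithmetic: `C (a (e K) + E₁) + C (B₁ + E₂) ≤ C (2500 + 720 C₉ D²)(R+1) s`. [folklore] -/
theorem final_numerics33 {C C₉ D s R a e K E₁ B₁ E₂ : ℝ} (hC : 0 ≤ C) (hC₉ : 0 ≤ C₉)
    (hs : 0 ≤ s) (hR : 0 ≤ R) (hK : 0 ≤ K)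
    (h1 : a * e ≤ 30 * s) (h5 : K ≤ 82 * (R + 1)) (h2 : E₁ ≤ 4 * (R + 1) * s)
    (h3 : B₁ ≤ 720 * C₉ * D ^ 2 * s) (h4 : E₂ ≤ 4 * (R + 1) * s) :
    C * (a * (e * K) + E₁) + C * (B₁ + E₂) ≤ C * (2500 + 720 * C₉ * D ^ 2) * (R + 1) * s := by
  have hK' : a * (e * K) ≤ 30 * s * (82 * (R + 1)) := by
    rw [← mul_assoc]; exact mul_le_mul h1 h5 hK (by positivity)
  have hB' : B₁ ≤ 720 * C₉ * D ^ 2 * ((R + 1) * s) := by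
    refine h3.trans ?_
    have : s ≤ (R + 1) * s := by nlinarith
    exact mul_le_mul_of_nonneg_left this (by positivity)
  have hin : (a * (e * K) + E₁) + (B₁ + E₂) ≤ (2500 + 720 * C₉ * D ^ 2) * (R + 1) * s := by nlinarith
  calc C * (a * (e * K) + E₁) + C * (B₁ + E₂) = C * ((a * (e * K) + E₁) + (B₁ + E₂)) := by ring
    _ ≤ C * ((2500 + 720 * C₉ * D ^ 2) * (R + 1) * s) := mul_le_mul_of_nonneg_left hin hC
    _ = _ := by ring

end Literature.NumberTheory.Sieve.Lichtman2020

namespace Literature.NumberTheory.Sieve.Lichtman2020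

/-! ### The count of bad intervals at a large `X` (printed first exponent, `α = 3/20`) -/

/-- Exponentiating the additive condition: from
`log 2304 + (9/10) log 3 + L^{3/4} + L^{1-δ/2} + (9A+1) log L ≤ (1/10) L` (`L = log X`), the product
bound `2304 L^{3A} L exp((3/10)L^{3/4}) (3X)^{9/10} exp(L^{1-δ/2}) L^{6A} ≤ X`. [folklore] -/
theorem exp_form_F12_33 {X : ℕ} {δ A : ℝ} (hL : 64 ≤ Real.log X)
    (h : Real.log 2304 + 9 / 10 * Real.log 3 + Real.log X ^ (3 / 4 : ℝ) + Real.log X ^ (1 - δ / 2)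
      + (9 * A + 1) * Real.log (Real.log X) ≤ 1 / 10 * Real.log X) :
    2304 * Real.log X ^ (3 * A) * Real.log X * Real.exp (3 / 10 * Real.log X ^ (3 / 4 : ℝ)) *
        (3 * (X : ℝ)) ^ (9 / 10 : ℝ) * Real.exp (Real.log X ^ (1 - δ / 2)) * Real.log X ^ (6 * A) ≤ X := by
  obtain ⟨hX3, hX0⟩ := X_large hL
  set L := Real.log X with hLdef
  have hL0 : 0 < L := by linarith
  have eX : (X : ℝ) = Real.exp L := (Real.exp_log hX0).symm
  have e2 : L ^ (3 * A) = Real.exp (3 * A * Real.log L) := by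
    rw [Real.rpow_def_of_pos hL0]; ring_nf
  have e4 : (3 * (X : ℝ)) ^ (9 / 10 : ℝ) = Real.exp (9 / 10 * (Real.log 3 + L)) := by
    rw [Real.rpow_def_of_pos (by linarith), Real.log_mul (by norm_num) hX0.ne', ← hLdef]; ring_nf
  have e5 : L ^ (6 * A) = Real.exp (6 * A * Real.log L) := by
    rw [Real.rpow_def_of_pos hL0]; ring_nf
  have eq : 2304 * L ^ (3 * A) * L * Real.exp (3 / 10 * L ^ (3 / 4 : ℝ)) *
      (3 * (X : ℝ)) ^ (9 / 10 : ℝ) * Real.exp (L ^ (1 - δ / 2)) * L ^ (6 * A) =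
      Real.exp (Real.log 2304 + 3 * A * Real.log L + Real.log L + 3 / 10 * L ^ (3 / 4 : ℝ)
        + 9 / 10 * (Real.log 3 + L) + L ^ (1 - δ / 2) + 6 * A * Real.log L) := by
    rw [Real.exp_add, Real.exp_add, Real.exp_add, Real.exp_add, Real.exp_add, Real.exp_add,
      Real.exp_log (by norm_num : (0 : ℝ) < 2304), Real.exp_log hL0, ← e2, ← e4, ← e5]
  rw [eq, eX, Real.exp_le_exp]
  have h34 : 0 ≤ L ^ (3 / 4 : ℝ) := Real.rpow_nonneg hL0.le _
  have r1 : (9 * A + 1) * Real.log L = 3 * A * Real.log L + Real.log L + 6 * A * Real.log L := by ring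
  rw [r1] at h
  nlinarith

set_option maxHeartbeats 1600000 in
-- explicit-constant bookkeeping for the count of bad intervals
/-- **(5.10) at a large `X`, printed first exponent**: with `V = L^{3A}`, `α = 3/20`, `P₁ = L^{cA}`,
`cA ≥ 165`, every set `B` of bad unit intervals below `T' = ⌊T⌋ + 1 ≤ 3X` has `#B √T' ≤ Y/Q₂`: for
`T' ≤ X^{1/4}` trivially (`#B ≤ T'`, `X^{3/8} Q₂ L^{6A} ≤ X`), otherwise by `card_bad_le`
(`#ℐ₁ ≤ 2VL`, `Q₁^{3/10} ≤ exp((3/10)L^{3/4})`, `T' ≤ 3X`, and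
`exp(16 (V log T'/v₀) log log T') ≤ T'^{1/10}` as `v₀ ≥ V(cA log L - 1)`, `log log T' ≤ log L + 1/128`).
[cite: Lichtman2020, (5.10)] -/
theorem cardB_bound33 {q : ℕ} (χ : DirichletCharacter ℂ q) {c A : ℝ} {X Hx N₀ : ℕ} {Y T Q₂ : ℝ}
    (hL : 256 ≤ Real.log X) (hcA : 165 ≤ c * A) (hA : 1 ≤ A) (hc1 : 1 ≤ c)
    (hHx : (Hx : ℝ) ≤ Real.exp (Real.log X ^ (3 / 4 : ℝ)))
    (hPQ₁ : Real.log X ^ (c * A) ≤ (Hx : ℝ) / Real.log X ^ (4 * A))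
    (hT2X : T ≤ 2 * X) (hYlo : (X : ℝ) / Real.log X ^ (6 * A) ≤ Y) (hQ₂1 : 1 ≤ Q₂)
    (hF8 : (X : ℝ) ^ (3 / 8 : ℝ) * Q₂ * Real.log X ^ (6 * A) ≤ X)
    (hF12 : 2304 * Real.log X ^ (3 * A) * Real.log X * Real.exp (3 / 10 * Real.log X ^ (3 / 4 : ℝ)) *
        (3 * (X : ℝ)) ^ (9 / 10 : ℝ) * Q₂ * Real.log X ^ (6 * A) ≤ X)
    (B : Finset ℕ) (hBsub : B ⊆ Finset.Ico N₀ (⌊T⌋₊ + 1))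
    (hbad : ∀ n ∈ B, ∃ t ∈ Set.Icc (n : ℝ) (n + 1),
      ∃ u ∈ Icc ⌊Real.log X ^ (3 * A) * Real.log (Real.log X ^ (c * A))⌋₊
        ⌊Real.log X ^ (3 * A) * Real.log ((Hx : ℝ) / Real.log X ^ (4 * A))⌋₊,
        Real.exp (-(3 / 20 * u / Real.log X ^ (3 * A))) <
          ‖blockPrimePoly (lamChi χ) (Real.log X ^ (c * A)) ((Hx : ℝ) / Real.log X ^ (4 * A))
            (Real.log X ^ (3 * A)) u t‖) :
    (#B : ℝ) * Real.sqrt ((⌊T⌋₊ : ℝ) + 1) ≤ Y / Q₂ := by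
  have hL64 : 64 ≤ Real.log X := by linarith
  obtain ⟨hX3, hX0⟩ := X_large hL64
  obtain ⟨hlog3, hlog2⟩ := log_three_le_two
  set L := Real.log X with hLdef
  set V := L ^ (3 * A) with hVdef
  set P₁ := L ^ (c * A) with hP₁def
  set Q₁ := (Hx : ℝ) / L ^ (4 * A) with hQ₁def
  set T' : ℝ := (⌊T⌋₊ : ℝ) + 1 with hT'def
  have hL1 : 1 ≤ L := by linarith
  have hL0 : 0 < L := by linarith
  have hX1 : (1 : ℝ) ≤ X := by linarith
  have hQ₂0 : 0 < Q₂ := by linarith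
  have hV1 : 1 ≤ V := Real.one_le_rpow hL1 (by positivity)
  have hV0 : 0 < V := by linarith
  have hP₁L : L ≤ P₁ := by
    calc L = L ^ (1 : ℝ) := (Real.rpow_one L).symm
      _ ≤ L ^ (c * A) := Real.rpow_le_rpow_of_exponent_le hL1 (by nlinarith)
  have hP₁0 : 0 < P₁ := by linarith
  have hQ₁1 : 1 ≤ Q₁ := le_trans (by linarith) hPQ₁
  have hQ₁0 : 0 < Q₁ := by linarith
  have h4A : 1 ≤ L ^ (4 * A) := Real.one_le_rpow hL1 (by positivity)
  have hQ₁H : Q₁ ≤ Hx := div_le_self (Nat.cast_nonneg _) h4A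
  have h34L : L ^ (3 / 4 : ℝ) ≤ L := by
    calc L ^ (3 / 4 : ℝ) ≤ L ^ (1 : ℝ) := Real.rpow_le_rpow_of_exponent_le hL1 (by norm_num)
      _ = L := Real.rpow_one L
  have hlogQ₁ : Real.log Q₁ ≤ L := by
    have h1 : Q₁ ≤ Real.exp (L ^ (3 / 4 : ℝ)) := hQ₁H.trans hHx
    have h2 : Real.log Q₁ ≤ L ^ (3 / 4 : ℝ) := by
      rw [← Real.log_exp (L ^ (3 / 4 : ℝ))]; exact Real.log_le_log hQ₁0 h1
    linarith
  -- `T'`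
  have hT'1 : 1 ≤ T' := by simp [hT'def]
  have hT'0 : 0 < T' := by linarith
  have hT'3X : T' ≤ 3 * X := by
    have h1 : (⌊T⌋₊ : ℝ) ≤ max T 0 := by
      rcases le_or_gt 0 T with h | h
      · rw [max_eq_left h]; exact Nat.floor_le h
      · rw [Nat.floor_of_nonpos h.le]; simp
    have h2 : max T 0 ≤ 2 * X := max_le hT2X (by positivity)
    simp only [hT'def]; linarith
  -- the target through `X/(L^{6A} Q₂) ≤ Y/Q₂`
  have h6A : 0 < L ^ (6 * A) := Real.rpow_pos_of_pos hL0 _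
  have hgoal : ∀ Z : ℝ, Z * Q₂ * L ^ (6 * A) ≤ X → Z ≤ Y / Q₂ := by
    intro Z hZ
    rw [le_div_iff₀ hQ₂0]
    have h1 : Z * Q₂ ≤ X / L ^ (6 * A) := by
      rw [le_div_iff₀ h6A]; exact hZ
    exact h1.trans hYlo
  -- two cases
  rcases le_or_gt T' ((X : ℝ) ^ (1 / 4 : ℝ)) with hsmall | hlarge
  · -- trivial count
    apply hgoal
    have hcard : (#B : ℝ) ≤ T' := by
      have h1 := Finset.card_le_card hBsub
      rw [Nat.card_Ico] at h1
      have h2 : #B ≤ ⌊T⌋₊ + 1 := h1.trans (Nat.sub_le _ _)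
      simp only [hT'def]; exact_mod_cast h2
    have hsq : Real.sqrt T' ≤ (X : ℝ) ^ (1 / 8 : ℝ) := by
      rw [Real.sqrt_eq_rpow]
      calc T' ^ (1 / 2 : ℝ) ≤ ((X : ℝ) ^ (1 / 4 : ℝ)) ^ (1 / 2 : ℝ) :=
            Real.rpow_le_rpow hT'0.le hsmall (by norm_num)
        _ = (X : ℝ) ^ (1 / 8 : ℝ) := by rw [← Real.rpow_mul hX0.le]; norm_num
    have h38 : (#B : ℝ) * Real.sqrt T' ≤ (X : ℝ) ^ (3 / 8 : ℝ) := by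
      calc (#B : ℝ) * Real.sqrt T' ≤ (X : ℝ) ^ (1 / 4 : ℝ) * (X : ℝ) ^ (1 / 8 : ℝ) :=
            mul_le_mul (hcard.trans hsmall) hsq (Real.sqrt_nonneg _) (Real.rpow_nonneg hX0.le _)
        _ = (X : ℝ) ^ (3 / 8 : ℝ) := by rw [← Real.rpow_add hX0]; norm_num
    calc (#B : ℝ) * Real.sqrt T' * Q₂ * L ^ (6 * A) ≤ (X : ℝ) ^ (3 / 8 : ℝ) * Q₂ * L ^ (6 * A) := by
          gcongr
      _ ≤ X := hF8
  · -- Lemma 8 count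
    apply hgoal
    set v₀ := ⌊V * Real.log P₁⌋₊ with hv₀def
    have hlogP₁ : Real.log P₁ = c * A * Real.log L := by
      rw [hP₁def, Real.log_rpow hL0]
    have hlogL : 5 ≤ Real.log L := by
      have h1 : Real.log 256 ≤ Real.log L := Real.log_le_log (by norm_num) hL
      have h2 : (5 : ℝ) ≤ Real.log 256 := by
        rw [Real.le_log_iff_exp_le (by norm_num)]
        have he := Real.exp_one_lt_d9
        have hsq : Real.exp 1 ^ 2 ≤ 7.39 := by nlinarith [Real.exp_pos 1]
        have h4 : Real.exp 4 = (Real.exp 1 ^ 2) ^ 2 := by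
          rw [← pow_mul, ← Real.exp_nat_mul]; norm_num
        have h5 : Real.exp 5 = Real.exp 4 * Real.exp 1 := by rw [← Real.exp_add]; norm_num
        rw [h5, h4]; nlinarith [hsq, pow_nonneg (Real.exp_pos 1).le 2, Real.exp_pos 1]
      linarith
    have hcAlogL : c * A * Real.log L - 1 ≤ V * Real.log P₁ - 1 := by
      rw [hlogP₁]
      have h0 : 0 ≤ c * A * Real.log L := by positivity
      nlinarith
    have hVlogP₁ : 2 ≤ V * Real.log P₁ := by
      have : (2 : ℝ) + 1 ≤ c * A * Real.log L := by nlinarith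
      linarith
    have hv₀1 : 1 ≤ v₀ := by
      rw [hv₀def, Nat.one_le_floor_iff]; linarith
    have hv₀ge : V * (c * A * Real.log L - 1) ≤ (v₀ : ℝ) := by
      have h1 := Nat.lt_floor_add_one (V * Real.log P₁)
      rw [← hv₀def] at h1
      rw [hlogP₁] at h1
      have h2 : V * 1 ≥ 1 := by linarith
      nlinarith
    have hv₀0 : (0 : ℝ) < v₀ := by exact_mod_cast hv₀1
    -- blocks of the first interval in the range of Lemma 8
    have hXquarter : Real.exp (L ^ (3 / 4 : ℝ)) ≤ (X : ℝ) ^ (1 / 4 : ℝ) := by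
      rw [Real.rpow_def_of_pos hX0, ← hLdef, Real.exp_le_exp]
      -- `L^{3/4} ≤ L/4` as `4 ≤ L^{1/4}`
      have h14 : (4 : ℝ) ≤ L ^ (1 / 4 : ℝ) := by
        have : (256 : ℝ) ^ (1 / 4 : ℝ) ≤ L ^ (1 / 4 : ℝ) := Real.rpow_le_rpow (by norm_num) hL (by norm_num)
        have e : (256 : ℝ) ^ (1 / 4 : ℝ) = 4 := by
          rw [show (256 : ℝ) = 4 ^ (4 : ℝ) by norm_num, ← Real.rpow_mul (by norm_num)]; norm_num
        linarith
      have e2 : L = L ^ (3 / 4 : ℝ) * L ^ (1 / 4 : ℝ) := by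
        rw [← Real.rpow_add hL0]; norm_num
      have h0 : 0 ≤ L ^ (3 / 4 : ℝ) := Real.rpow_nonneg hL0.le _
      nlinarith
    have hTe : Real.exp (Real.exp 1) ≤ T' := by
      have h1 : Real.exp (Real.exp 1) ≤ Real.exp (L ^ (3 / 4 : ℝ)) := by
        rw [Real.exp_le_exp]
        have h2 : Real.exp 1 ≤ 3 := by have := Real.exp_one_lt_d9; linarith
        have h3 : (3 : ℝ) ≤ L ^ (3 / 4 : ℝ) := by
          have : (256 : ℝ) ^ (3 / 4 : ℝ) ≤ L ^ (3 / 4 : ℝ) := Real.rpow_le_rpow (by norm_num) hL (by norm_num)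
          have e : (256 : ℝ) ^ (3 / 4 : ℝ) = 64 := by
            rw [show (256 : ℝ) = 4 ^ (4 : ℝ) by norm_num, ← Real.rpow_mul (by norm_num)]; norm_num
          linarith
        linarith
      linarith
    have hblocks : ∀ u ∈ Icc v₀ ⌊V * Real.log Q₁⌋₊, 2 ≤ Real.exp (u / V) ∧ Real.exp (u / V) ≤ T' := by
      intro u hu
      rw [Finset.mem_Icc] at hu
      constructor
      · -- `e^{u/V} ≥ e^{log P₁ - 1} ≥ P₁/3 ≥ 2`
        have h1 : Real.log P₁ - 1 ≤ (u : ℝ) / V := by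
          rw [le_div_iff₀ hV0]
          have h2 : (v₀ : ℝ) ≤ u := by exact_mod_cast hu.1
          have h3 : V * Real.log P₁ - 1 ≤ (v₀ : ℝ) := by
            have := Nat.lt_floor_add_one (V * Real.log P₁); rw [hv₀def]; linarith
          nlinarith
        have h4 : Real.exp (Real.log P₁ - 1) ≤ Real.exp (u / V) := Real.exp_le_exp.mpr h1
        have h5 : Real.exp (Real.log P₁ - 1) = P₁ / Real.exp 1 := by
          rw [Real.exp_sub, Real.exp_log hP₁0]
        have h6 : Real.exp 1 ≤ 3 := by have := Real.exp_one_lt_d9; linarith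
        have h7 : 6 ≤ P₁ := by linarith
        have h8 : 2 ≤ P₁ / Real.exp 1 := by
          rw [le_div_iff₀ (Real.exp_pos 1)]; nlinarith
        linarith
      · -- `e^{u/V} ≤ Q₁ ≤ Hx ≤ exp(L^{3/4}) ≤ X^{1/4} < T'`
        have h1 : Real.exp (u / V) ≤ Q₁ := by
          have := exp_mul_div_le_rpow hV0 hQ₁1 zero_le_one hu.2
          simpa using this
        calc Real.exp (u / V) ≤ Q₁ := h1
          _ ≤ Hx := hQ₁H
          _ ≤ Real.exp (L ^ (3 / 4 : ℝ)) := hHx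
          _ ≤ (X : ℝ) ^ (1 / 4 : ℝ) := hXquarter
          _ ≤ T' := hlarge.le
    have hB' : ∀ n ∈ B, n ≤ ⌊T⌋₊ ∧ ∃ t ∈ Set.Icc (n : ℝ) (n + 1), ∃ u ∈ Icc v₀ ⌊V * Real.log Q₁⌋₊,
        Real.exp (-(3 / 20 * u / V)) < ‖blockPrimePoly (lamChi χ) P₁ Q₁ V u t‖ := by
      intro n hn
      refine ⟨?_, hbad n hn⟩
      have := Finset.mem_Ico.mp (hBsub hn); omega
    have hV2 : (2 : ℝ) ≤ V := by
      calc (2 : ℝ) ≤ L := by linarith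
        _ = L ^ (1 : ℝ) := (Real.rpow_one L).symm
        _ ≤ L ^ (3 * A) := Real.rpow_le_rpow_of_exponent_le hL1 (by nlinarith)
    have key := card_bad_le (norm_lamChi_le χ) hV2 (by norm_num : (0 : ℝ) < 3 / 20)
      hQ₁1 hv₀1 ⌊T⌋₊ hTe hblocks B hB'
    -- bound the factors
    have hI : (#(Icc v₀ ⌊V * Real.log Q₁⌋₊) : ℝ) ≤ 2 * V * L := by
      rw [Nat.card_Icc]
      have h1 : ((⌊V * Real.log Q₁⌋₊ + 1 - v₀ : ℕ) : ℝ) ≤ ⌊V * Real.log Q₁⌋₊ + 1 := by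
        exact_mod_cast Nat.sub_le _ _
      refine h1.trans ?_
      have h2 : (⌊V * Real.log Q₁⌋₊ : ℝ) ≤ V * Real.log Q₁ :=
        Nat.floor_le (mul_nonneg hV0.le (Real.log_nonneg hQ₁1))
      have h3 : V * Real.log Q₁ ≤ V * L := mul_le_mul_of_nonneg_left hlogQ₁ hV0.le
      have h4 : 1 ≤ V * L := by nlinarith
      linarith
    have h2α : (2 * (3 / 20) : ℝ) = 3 / 10 := by norm_num
    rw [h2α] at key
    have hQ13 : Q₁ ^ (3 / 10 : ℝ) ≤ Real.exp (3 / 10 * L ^ (3 / 4 : ℝ)) := by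
      calc Q₁ ^ (3 / 10 : ℝ) ≤ (Real.exp (L ^ (3 / 4 : ℝ))) ^ (3 / 10 : ℝ) :=
            Real.rpow_le_rpow hQ₁0.le (hQ₁H.trans hHx) (by norm_num)
        _ = Real.exp (3 / 10 * L ^ (3 / 4 : ℝ)) := by rw [← Real.exp_mul]; ring_nf
    have h3X0 : (0 : ℝ) < 3 * X := by positivity
    have hT13 : T' ^ (3 / 10 : ℝ) ≤ (3 * (X : ℝ)) ^ (3 / 10 : ℝ) :=
      Real.rpow_le_rpow hT'0.le hT'3X (by norm_num)
    -- the exponential factor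
    have hlogT' : 1 ≤ Real.log T' := by
      rw [← Real.log_exp 1]
      refine Real.log_le_log (Real.exp_pos 1) ?_
      have : Real.exp 1 ≤ Real.exp (Real.exp 1) := Real.exp_le_exp.mpr (by have := Real.add_one_le_exp (1:ℝ); linarith)
      linarith
    have hlogT'0 : 0 ≤ Real.log T' := by linarith
    have hllT' : Real.log (Real.log T') ≤ Real.log L + 1 / 128 := by
      have h1 : Real.log T' ≤ Real.log 3 + L := by
        rw [hLdef, ← Real.log_mul (by norm_num) hX0.ne']
        exact Real.log_le_log hT'0 hT'3X
      have h2 : Real.log 3 + L ≤ L * (1 + 1 / 128) := by nlinarith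
      have h3 : Real.log (L * (1 + 1 / 128)) = Real.log L + Real.log (1 + 1 / 128) :=
        Real.log_mul hL0.ne' (by norm_num)
      have h4 : Real.log (1 + 1 / 128) ≤ 1 / 128 := by
        have := Real.log_le_sub_one_of_pos (show (0 : ℝ) < 1 + 1 / 128 by norm_num); linarith
      calc Real.log (Real.log T') ≤ Real.log (L * (1 + 1 / 128)) :=
            Real.log_le_log (by linarith) (h1.trans h2)
        _ ≤ Real.log L + 1 / 128 := by rw [h3]; linarith
    have hllT'0 : 0 ≤ Real.log (Real.log T') := Real.log_nonneg hlogT'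
    have hE : Real.exp (16 * (V * Real.log T' / v₀) * Real.log (Real.log T')) ≤ (3 * (X : ℝ)) ^ (1 / 10 : ℝ) := by
      have h1 : 16 * (V * Real.log T' / v₀) * Real.log (Real.log T') ≤ 1 / 10 * Real.log T' := by
        -- `16 V log log T'/v₀ ≤ 1/10`
        have h2 : 16 * V * Real.log (Real.log T') / v₀ ≤ 1 / 10 := by
          rw [div_le_iff₀ hv₀0]
          -- `160 V (log L + 1/128) ≤ V (cA log L - 1) ≤ v₀`
          have h3 : 16 * V * Real.log (Real.log T') ≤ 16 * V * (Real.log L + 1 / 128) :=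
            mul_le_mul_of_nonneg_left hllT' (by positivity)
          have h4 : 16 * V * (Real.log L + 1 / 128) ≤ 1 / 10 * (V * (c * A * Real.log L - 1)) := by
            have h5 : 16 * (Real.log L + 1 / 128) ≤ 1 / 10 * (c * A * Real.log L - 1) := by
              nlinarith
            nlinarith
          nlinarith
        have e : 16 * (V * Real.log T' / v₀) * Real.log (Real.log T') =
            (16 * V * Real.log (Real.log T') / v₀) * Real.log T' := by
          field_simp
        rw [e]
        exact mul_le_mul_of_nonneg_right h2 hlogT'0
      calc Real.exp (16 * (V * Real.log T' / v₀) * Real.log (Real.log T'))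
          ≤ Real.exp (1 / 10 * Real.log T') := Real.exp_le_exp.mpr h1
        _ = T' ^ (1 / 10 : ℝ) := by rw [Real.rpow_def_of_pos hT'0]; ring_nf
        _ ≤ (3 * (X : ℝ)) ^ (1 / 10 : ℝ) := Real.rpow_le_rpow hT'0.le hT'3X (by positivity)
    have hsqrt : Real.sqrt T' ≤ (3 * (X : ℝ)) ^ (1 / 2 : ℝ) := by
      rw [Real.sqrt_eq_rpow]; exact Real.rpow_le_rpow hT'0.le hT'3X (by norm_num)
    -- assemble
    have hE0 : 0 ≤ Real.exp (16 * (V * Real.log T' / v₀) * Real.log (Real.log T')) := (Real.exp_pos _).le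
    have hprod : (#B : ℝ) * Real.sqrt T' ≤
        2 * V * L * (1152 * Real.exp (3 / 10 * L ^ (3 / 4 : ℝ)) * (3 * (X : ℝ)) ^ (3 / 10 : ℝ) *
          (3 * (X : ℝ)) ^ (1 / 10 : ℝ)) * (3 * (X : ℝ)) ^ (1 / 2 : ℝ) := by
      have h1 : (#B : ℝ) ≤ 2 * V * L * (1152 * Real.exp (3 / 10 * L ^ (3 / 4 : ℝ)) * (3 * (X : ℝ)) ^ (3 / 10 : ℝ) *
          (3 * (X : ℝ)) ^ (1 / 10 : ℝ)) := by
        refine key.trans ?_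
        have hfac : 1152 * Q₁ ^ (3 / 10 : ℝ) * T' ^ (3 / 10 : ℝ) *
            Real.exp (16 * (V * Real.log T' / v₀) * Real.log (Real.log T')) ≤
            1152 * Real.exp (3 / 10 * L ^ (3 / 4 : ℝ)) * (3 * (X : ℝ)) ^ (3 / 10 : ℝ) * (3 * (X : ℝ)) ^ (1 / 10 : ℝ) := by
          gcongr
        have hfac0 : 0 ≤ 1152 * Q₁ ^ (3 / 10 : ℝ) * T' ^ (3 / 10 : ℝ) *
            Real.exp (16 * (V * Real.log T' / v₀) * Real.log (Real.log T')) := by positivity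
        calc (#(Icc v₀ ⌊V * Real.log Q₁⌋₊) : ℝ) * (1152 * Q₁ ^ (3 / 10 : ℝ) * (((⌊T⌋₊ : ℕ) : ℝ) + 1) ^ (3 / 10 : ℝ) *
              Real.exp (16 * (V * Real.log (((⌊T⌋₊ : ℕ) : ℝ) + 1) / v₀) * Real.log (Real.log (((⌊T⌋₊ : ℕ) : ℝ) + 1))))
            ≤ (2 * V * L) * (1152 * Q₁ ^ (3 / 10 : ℝ) * T' ^ (3 / 10 : ℝ) *
              Real.exp (16 * (V * Real.log T' / v₀) * Real.log (Real.log T'))) :=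
              mul_le_mul_of_nonneg_right hI hfac0
          _ ≤ (2 * V * L) * (1152 * Real.exp (3 / 10 * L ^ (3 / 4 : ℝ)) * (3 * (X : ℝ)) ^ (3 / 10 : ℝ) *
              (3 * (X : ℝ)) ^ (1 / 10 : ℝ)) := mul_le_mul_of_nonneg_left hfac (by positivity)
      exact mul_le_mul h1 hsqrt (Real.sqrt_nonneg _) ((Nat.cast_nonneg _).trans h1)
    have hcomb : 2 * V * L * (1152 * Real.exp (3 / 10 * L ^ (3 / 4 : ℝ)) * (3 * (X : ℝ)) ^ (3 / 10 : ℝ) *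
          (3 * (X : ℝ)) ^ (1 / 10 : ℝ)) * (3 * (X : ℝ)) ^ (1 / 2 : ℝ) =
        2304 * V * L * Real.exp (3 / 10 * L ^ (3 / 4 : ℝ)) * (3 * (X : ℝ)) ^ (9 / 10 : ℝ) := by
      have e : (3 * (X : ℝ)) ^ (9 / 10 : ℝ) =
          (3 * (X : ℝ)) ^ (3 / 10 : ℝ) * (3 * (X : ℝ)) ^ (1 / 10 : ℝ) * (3 * (X : ℝ)) ^ (1 / 2 : ℝ) := by
        rw [← Real.rpow_add h3X0, ← Real.rpow_add h3X0]; norm_num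
      rw [e]; ring
    rw [hcomb] at hprod
    calc (#B : ℝ) * Real.sqrt T' * Q₂ * L ^ (6 * A)
        ≤ 2304 * V * L * Real.exp (3 / 10 * L ^ (3 / 4 : ℝ)) * (3 * (X : ℝ)) ^ (9 / 10 : ℝ) * Q₂ * L ^ (6 * A) := by
          gcongr
      _ ≤ X := hF12

end Literature.NumberTheory.Sieve.Lichtman2020

namespace Literature.NumberTheory.Sieve.Lichtman2020

/-! ### Proposition 5.1 at the printed first exponent, saving `(log X)^{-3A}` -/

set_option maxHeartbeats 3200000 in
-- the asymptotic wrapper: many eventual side conditions, one long proof (as `dirichletMeanValue_strong`)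
/-- **Lichtman 2020, Proposition 5.1 at the printed first exponent (`P₁ = (log X)^{cA}`, any `c ≥ 33`),
in the printed regime `ψ(X) ≤ (log X)^{2/3}`, with saving `(log X)^{-3A}`** — PROVED from the named
fact Lemma 4.5 (`Lichtman2020_primeCharacterSum`), all other inputs being proved in the tree
(Lemma 4.7 = MR Lemma 12 `MatomakiRadziwill2016_lemma12_decomp_holds`, Lemma 4.3 = MR Lemma 9
`MatomakiRadziwill2016_lemma9_holds`, Lemma 4.1, Lemma 4.4 with explicit exponent).  For `q ≤ (log X)^A`,
`χ (mod q)`, `Y ∈ [X/(log X)^{6A}, 2X]`, `T ∈ [0, 2X]`, with `Q₁ = H/(log X)^{4A}`: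
`∫_{(log X)^{6A}}^{T} |∑_{Y ≤ n ≤ 2Y, n ∈ S_c} λ(n)χ(n)n^{-1-it}|² dt ≤ C (Q₁T/Y + 1)(log X)^{-3A}`.
Parameters `B = 3A`, `V = (log X)^B`, `T₀ = (log X)^{2B}`, `α = 3/20`, `K = 6A`; see the module
docstring for why `B = 3A` is what the printed method gives at the printed `P₁`.
[cite: Lichtman2020, Proposition 5.1] -/
theorem dirichletMeanValue33 (h45 : Lichtman2020_primeCharacterSum) :
    ∀ c : ℝ, 33 ≤ c → ∀ A : ℝ, 5 < A → ∀ δ : ℝ, 0 < δ → ∀ H : ℕ → ℕ,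
    Tendsto (fun X : ℕ => Real.log (H X) / Real.log (Real.log X)) atTop atTop →
    (∀ᶠ X : ℕ in atTop, Real.log (H X) / Real.log (Real.log X) ≤ Real.log X ^ (2 / 3 : ℝ)) →
    ∃ C : ℝ, ∀ᶠ X : ℕ in atTop, ∀ q : ℕ, 1 ≤ q → (q : ℝ) ≤ Real.log X ^ A →
      ∀ χ : DirichletCharacter ℂ q, ∀ Y : ℝ, (X : ℝ) / Real.log X ^ (6 * A) ≤ Y → Y ≤ 2 * X →
        ∀ T : ℝ, 0 ≤ T → T ≤ 2 * X →
          ∫ t in (Real.log X ^ (6 * A))..T,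
              ‖∑ n ∈ (Icc ⌈Y⌉₊ ⌊2 * Y⌋₊).filter (lichtmanTypicalWith c X A δ (H X)),
                  ((ArithmeticFunction.liouville n : ℤ) : ℂ) * χ (n : ZMod q) *
                    (n : ℂ) ^ (-(1 + (t : ℂ) * I))‖ ^ 2
            ≤ C * (((H X : ℝ) / Real.log X ^ (4 * A)) * T / Y + 1) / Real.log X ^ (3 * A) := by
  intro c hc A hA δ hδ H hH hψ
  obtain ⟨C₁₂, h12'⟩ := lemma12With_of_decomp MatomakiRadziwill2016_lemma12_decomp_holds
  obtain ⟨C₉, h9'⟩ := lemma9With_of Literature.NumberTheory.LFunctions.MatomakiRadziwill2016_lemma9_holds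
  have hA0 : 0 < A := by linarith
  have hA1 : 1 ≤ A := by linarith
  have hA2 : 2 ≤ A := by linarith
  have hc1 : 1 ≤ c := by linarith
  obtain ⟨C₄₅, h45'⟩ := h45 A (6 * A) (2 / 3 + δ / 4) hA0 (by positivity) (by linarith)
  set D := max C₄₅ 0 with hD
  have hD0 : 0 ≤ D := le_max_right _ _
  set Cf : ℝ := max C₁₂ 0 * (2500 + 720 * max C₉ 0 * D ^ 2) with hCf
  refine ⟨Cf, ?_⟩
  have hcA : 165 ≤ c * A := by nlinarith
  have hcA0 : 0 < c * A := by linarith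
  filter_upwards [tendsto_log_natCast.eventually_ge_atTop (256 : ℝ),
    eventually_H_le_exp_of_psi hψ (e := 3 / 4) (by norm_num),
    eventually_H_lt_P2_of_psi hψ hδ,
    eventually_rpow_log_le_H hH ((c + 4) * A + 1),
    eventually_small_terms 0 (6 * A) (show (3 / 4 : ℝ) < 1 by norm_num) (show (3 / 4 : ℝ) < 1 by norm_num) one_pos,
    eventually_small_terms (Real.log 2) (6 * A) (show 1 - δ / 2 < 1 by linarith)
      (show 1 - δ / 2 < 1 by linarith) one_pos,
    eventually_small_terms 0 (6 * A) (show 1 - δ / 2 < 1 by linarith) (show (3 / 4 : ℝ) < 1 by norm_num)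
      (show (0 : ℝ) < 5 / 8 by norm_num),
    eventually_small_terms (Real.log 2304 + 9 / 10 * Real.log 3) (9 * A + 1) (show (3 / 4 : ℝ) < 1 by norm_num)
      (show 1 - δ / 2 < 1 by linarith) (show (0 : ℝ) < 1 / 10 by norm_num),
    (tendsto_natCast_atTop_atTop (R := ℝ)).eventually
      (eventually_loglog_le (2 / 3 + δ / 2) (1 / (3 * A)) (by positivity) (by positivity)),
    ((tendsto_rpow_atTop (by positivity : (0 : ℝ) < δ / 4)).comp tendsto_log_natCast).eventually_ge_atTop
      ((2 : ℝ) ^ (2 / 3 + δ / 4))]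
    with X hL256 hHx hHP₂ hHlow hF4 hF5 hF8 hF12 hF13 hF6
  intro q hq hqA χ Y hYlo hYhi T hT0 hT2X
  have hL64 : 64 ≤ Real.log X := by linarith
  obtain ⟨hX3, hX0⟩ := X_large hL64
  set L := Real.log X with hLdef
  have hL1 : 1 ≤ L := by linarith
  have hL1' : 1 < L := by linarith
  have hL0 : 0 < L := by linarith
  set Hx := H X with hHxdef
  set V := L ^ (3 * A) with hVdef
  set T₀ := L ^ (6 * A) with hT₀def
  set P₁ := L ^ (c * A) with hP₁def
  set Q₁ := (Hx : ℝ) / L ^ (4 * A) with hQ₁def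
  set P₂ := Real.exp (L ^ (2 / 3 + δ / 2)) with hP₂def
  set Q₂ := Real.exp (L ^ (1 - δ / 2)) with hQ₂def
  -- basic positivity
  have hV1 : 1 ≤ V := Real.one_le_rpow hL1 (by positivity)
  have hV0 : 0 < V := by linarith
  have hV2 : 2 ≤ V := by
    calc (2 : ℝ) ≤ L := by linarith
      _ = L ^ (1 : ℝ) := (Real.rpow_one L).symm
      _ ≤ L ^ (3 * A) := Real.rpow_le_rpow_of_exponent_le hL1 (by nlinarith)
  have hT₀0 : 0 ≤ T₀ := Real.rpow_nonneg hL0.le _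
  have hP₁1 : 1 ≤ P₁ := Real.one_le_rpow hL1 (by positivity)
  have hP₁0 : 0 < P₁ := by linarith
  have h4A1 : 1 ≤ L ^ (4 * A) := Real.one_le_rpow hL1 (by positivity)
  have h4A0 : 0 < L ^ (4 * A) := by linarith
  have h6A1 : 1 ≤ L ^ (6 * A) := Real.one_le_rpow hL1 (by positivity)
  have h6A0 : 0 < L ^ (6 * A) := by linarith
  have hP₂1 : 1 ≤ P₂ := Real.one_le_exp (Real.rpow_nonneg hL0.le _)
  have hQ₂1 : 1 ≤ Q₂ := Real.one_le_exp (Real.rpow_nonneg hL0.le _)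
  have hQ₂0 : 0 < Q₂ := by linarith
  -- `P₁ L ≤ Q₁` from `L^{(c+4)A+1} ≤ Hx`
  have hsplit : L ^ ((c + 4) * A + 1) = P₁ * L ^ (4 * A) * L := by
    rw [hP₁def, ← Real.rpow_add hL0, Real.rpow_add_one hL0.ne']; congr 1; ring
  have hPQ₁L : P₁ * L ≤ Q₁ := by
    rw [hQ₁def, le_div_iff₀ h4A0]
    calc P₁ * L * L ^ (4 * A) = L ^ ((c + 4) * A + 1) := by rw [hsplit]; ring
      _ ≤ Hx := hHlow
  have hPQ₁ : P₁ ≤ Q₁ := le_trans (le_mul_of_one_le_right hP₁0.le hL1) hPQ₁L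
  have hQ₁1 : 1 ≤ Q₁ := hP₁1.trans hPQ₁
  have hQ₁0 : 0 < Q₁ := by linarith
  have hQ₁H : Q₁ ≤ Hx := div_le_self (Nat.cast_nonneg _) h4A1
  -- `Hx ≤ X/L^{6A} ≤ Y`
  have h34nn : 0 ≤ Real.log (X : ℝ) ^ (3 / 4 : ℝ) := Real.rpow_nonneg hL0.le _
  have hF4' : Real.exp (L ^ (3 / 4 : ℝ)) * L ^ (6 * A) ≤ X := by
    have h := exp_form_gen hL64 (k := 0) (a := 3 / 4) (b := 6 * A) (by linarith)
    simpa using h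
  have hHxY : (Hx : ℝ) ≤ X / L ^ (6 * A) := by
    rw [le_div_iff₀ h6A0]
    calc (Hx : ℝ) * L ^ (6 * A) ≤ Real.exp (L ^ (3 / 4 : ℝ)) * L ^ (6 * A) := by gcongr
      _ ≤ X := hF4'
  have hHxX : (Hx : ℝ) ≤ X := hHxY.trans (div_le_self hX0.le h6A1)
  have hQ₁Y : Q₁ ≤ Y := hQ₁H.trans (hHxY.trans hYlo)
  have hY1 : 1 ≤ Y := hQ₁1.trans hQ₁Y
  have hY0 : 0 < Y := by linarith
  have hlogQ₁ : Real.log Q₁ ≤ L := by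
    calc Real.log Q₁ ≤ Real.log X := Real.log_le_log hQ₁0 (hQ₁H.trans hHxX)
      _ = L := rfl
  -- `2 Q₂ ≤ X/L^{6A} ≤ Y`
  have hF5' : 2 * Q₂ * L ^ (6 * A) ≤ X := by
    have h := exp_form_gen hL64 (k := Real.log 2) (a := 1 - δ / 2) (b := 6 * A) (by
      have : 0 ≤ Real.log (X : ℝ) ^ (1 - δ / 2) := Real.rpow_nonneg hL0.le _
      linarith)
    rwa [Real.exp_log (by norm_num : (0 : ℝ) < 2)] at h
  have hQ₂Y : 2 * Q₂ ≤ Y := by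
    have : 2 * Q₂ ≤ X / L ^ (6 * A) := by rw [le_div_iff₀ h6A0]; exact hF5'
    exact this.trans hYlo
  have hQ₂X : Q₂ ≤ X := by linarith
  -- `Q₁ < P₂`, `V ≤ P₂`, `exp((2L)^θ) ≤ P₂`
  have hQP : Q₁ < P₂ := lt_of_le_of_lt hQ₁H hHP₂
  have hVP₂ : V ≤ P₂ := by
    have h1 : 3 * A * Real.log L ≤ L ^ (2 / 3 + δ / 2) := by
      have h2 : Real.log L ≤ 1 / (3 * A) * L ^ (2 / 3 + δ / 2) := hF13
      have h3 := mul_le_mul_of_nonneg_left h2 (by positivity : (0 : ℝ) ≤ 3 * A)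
      refine h3.trans (le_of_eq ?_)
      field_simp
    calc V = Real.exp (3 * A * Real.log L) := by
          rw [hVdef, Real.rpow_def_of_pos hL0]; ring_nf
      _ ≤ P₂ := Real.exp_le_exp.mpr h1
  have hP₂' : Real.exp ((2 * Real.log X) ^ (2 / 3 + δ / 4)) ≤ P₂ := by
    rw [hP₂def, Real.exp_le_exp, ← hLdef, Real.mul_rpow (by norm_num) hL0.le]
    have e : L ^ (2 / 3 + δ / 2) = L ^ (δ / 4) * L ^ (2 / 3 + δ / 4) := by
      rw [← Real.rpow_add hL0]; congr 1; ring
    rw [e]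
    exact mul_le_mul_of_nonneg_right hF6 (Real.rpow_nonneg hL0.le _)
  -- the exponential forms of F8 and F12
  have hF8' : (X : ℝ) ^ (3 / 8 : ℝ) * Q₂ * L ^ (6 * A) ≤ X := by
    refine exp_form_F8 hL64 ?_
    linarith
  have hF12' := exp_form_F12_33 hL64 hF12
  -- degenerate case `P₂ > Q₂`: `S = ∅`
  have hRHS0 : 0 ≤ Cf * (((Hx : ℝ) / L ^ (4 * A)) * T / Y + 1) / L ^ (3 * A) := by
    have : 0 ≤ max C₁₂ 0 := le_max_right _ _
    have : 0 ≤ max C₉ 0 := le_max_right _ _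
    positivity
  rcases lt_or_ge Q₂ P₂ with hPQ₂ | hPQ₂
  · have hempty : (Icc ⌈Y⌉₊ ⌊2 * Y⌋₊).filter (lichtmanTypicalWith c X A δ Hx) = ∅ := by
      rw [Finset.filter_eq_empty_iff]
      intro n _ hS
      obtain ⟨-, p, -, h1, h2⟩ := hS
      exact absurd (h1.trans h2) (not_le.mpr hPQ₂)
    rw [hempty]
    simp only [Finset.sum_empty, norm_zero]
    rw [zero_pow two_ne_zero, intervalIntegral.integral_zero]
    exact hRHS0
  -- degenerate case `T < T₀`
  rcases lt_or_ge T T₀ with hTlt | hTge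
  · refine le_trans ?_ hRHS0
    rw [intervalIntegral.integral_symm]
    refine neg_nonpos.mpr (intervalIntegral.integral_nonneg hTlt.le fun t _ => by positivity)
  -- the hypotheses of `prop51_fixed`
  have hX'2 : (2 : ℝ) ≤ (X : ℝ) ^ 2 := by nlinarith
  have h45X := h45' ((X : ℝ) ^ 2) hX'2
  have hUQ : ∀ v ∈ Icc ⌊V * Real.log P₂⌋₊ ⌊V * Real.log Q₂⌋₊, ∀ n ∈ Finset.Ico ⌊T₀⌋₊ (⌊T⌋₊ + 1),
      ∀ t ∈ Set.Icc (n : ℝ) (n + 1), ‖blockPrimePoly (lamChi χ) P₂ Q₂ V v t‖ ≤ 3 * D * L ^ (1 - 6 * A) :=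
    fun v _ n hn t ht => UQ_bound' h45X hL64 hA0 (by positivity) hq hqA χ hP₂' hQ₂X hT2X v hn ht
  have hN1 : ∀ v ∈ Icc ⌊V * Real.log P₂⌋₊ ⌊V * Real.log Q₂⌋₊, 1 ≤ ⌊2 * Y * Real.exp (-(v / V))⌋₊ := by
    intro v hv
    rw [Nat.one_le_floor_iff]
    have h1 : Y / Q₂ ≤ Y * Real.exp (-(v / V)) :=
      div_le_mul_exp_neg hY0.le hV0 hQ₂1 (Finset.mem_Icc.mp hv).2
    have h2 : 2 ≤ Y / Q₂ := by rw [le_div_iff₀ hQ₂0]; linarith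
    linarith
  have hcardB : ∀ B : Finset ℕ, B ⊆ Finset.Ico ⌊T₀⌋₊ (⌊T⌋₊ + 1) →
      (∀ n ∈ B, ∃ t ∈ Set.Icc (n : ℝ) (n + 1), ∃ u ∈ Icc ⌊V * Real.log P₁⌋₊ ⌊V * Real.log Q₁⌋₊,
          Real.exp (-(3 / 20 * u / V)) < ‖blockPrimePoly (lamChi χ) P₁ Q₁ V u t‖) →
      ∀ v ∈ Icc ⌊V * Real.log P₂⌋₊ ⌊V * Real.log Q₂⌋₊,
        (#B : ℝ) * Real.sqrt ((⌊T⌋₊ : ℝ) + 1) ≤ ⌈Y * Real.exp (-(v / V))⌉₊ := by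
    intro B hBsub hbad v hv
    have h1 := cardB_bound33 χ hL256 hcA hA1 hc1 hHx hPQ₁ hT2X hYlo hQ₂1 hF8' hF12' B hBsub hbad
    exact h1.trans (div_le_cofactorWindow hY0.le hV0 hQ₂1 (Finset.mem_Icc.mp hv).2)
  -- the five numerical inequalities (before `key`, to keep `linarith` contexts small)
  have hsrpow : 1 / V = L ^ (-(3 * A)) := by rw [hVdef, Real.rpow_neg hL0.le, one_div]
  have hT'1 : (1 : ℝ) ≤ ((⌊T⌋₊ : ℕ) : ℝ) + 1 := by simp
  have hT'0 : (0 : ℝ) < ((⌊T⌋₊ : ℕ) : ℝ) + 1 := by linarith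
  have hT'T : ((⌊T⌋₊ : ℕ) : ℝ) + 1 ≤ T + 1 := by linarith [Nat.floor_le hT0]
  have hR0 : 0 ≤ Q₁ * T / Y := by positivity
  have hs0 : 0 < 1 / V := by positivity
  have h1 : (V * Real.log (Q₁ / P₁)) *
      (Real.exp (2 * (3 / 20 : ℝ) / V) * P₁ ^ (-(2 * (3 / 20 : ℝ))) * (1 + V / (2 * (3 / 20 : ℝ)))) ≤
      30 * (1 / V) := by
    rw [hsrpow]; exact E1_factor_numerics33 hL1 hA2 hc rfl rfl hPQ₁ hlogQ₁
  have hQT : Q₁ * (((⌊T⌋₊ : ℕ) : ℝ) + 1) / Y ≤ Q₁ * T / Y + 1 := by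
    rw [div_add_one (by linarith : Y ≠ 0), div_le_div_iff_of_pos_right hY0]
    have : Q₁ * (((⌊T⌋₊ : ℕ) : ℝ) + 1) ≤ Q₁ * (T + 1) := mul_le_mul_of_nonneg_left hT'T hQ₁0.le
    nlinarith [hQ₁Y]
  have h5 : 10 * Q₁ * (((⌊T⌋₊ : ℕ) : ℝ) + 1) / Y + 72 ≤ 82 * (Q₁ * T / Y + 1) := by
    have e : 10 * Q₁ * (((⌊T⌋₊ : ℕ) : ℝ) + 1) / Y = 10 * (Q₁ * (((⌊T⌋₊ : ℕ) : ℝ) + 1) / Y) := by ring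
    rw [e]; linarith [hQT, hR0]
  have hTY : ((((⌊T⌋₊ : ℕ) : ℝ) + 1) + Y) / Y ≤ Q₁ * T / Y + 2 := by
    rw [div_le_iff₀ hY0]
    have h1' : T ≤ Q₁ * T / Y * Y := by
      rw [div_mul_cancel₀ _ (by linarith : Y ≠ 0)]
      exact le_mul_of_one_le_left hT0 hQ₁1
    have h2' : (1 : ℝ) ≤ Y := hY1
    nlinarith [h1', h2', hT'T]
  have hVP₁ : V ≤ P₁ := Real.rpow_le_rpow_of_exponent_le hL1 (by nlinarith)
  have h2 : ((((⌊T⌋₊ : ℕ) : ℝ) + 1) + Y) / Y * (1 / V + 1 / P₁) ≤ 4 * (Q₁ * T / Y + 1) * (1 / V) :=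
    err_numerics hV0 hVP₁ hR0 hY0 hT'0.le hTY
  have h4 : ((((⌊T⌋₊ : ℕ) : ℝ) + 1) + Y) / Y * (1 / V + 1 / P₂) ≤ 4 * (Q₁ * T / Y + 1) * (1 / V) :=
    err_numerics hV0 hVP₂ hR0 hY0 hT'0.le hTY
  have hlog2T' : Real.log (2 * (((⌊T⌋₊ : ℕ) : ℝ) + 1)) ≤ 2 * L := by
    have h1' : 2 * (((⌊T⌋₊ : ℕ) : ℝ) + 1) ≤ (X : ℝ) ^ 2 := by nlinarith
    calc Real.log (2 * (((⌊T⌋₊ : ℕ) : ℝ) + 1)) ≤ Real.log ((X : ℝ) ^ 2) :=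
          Real.log_le_log (by linarith) h1'
      _ = 2 * L := by rw [Real.log_pow]; push_cast; ring
  have h3 : (V * Real.log (Q₂ / P₂)) * (#(Icc ⌊V * Real.log P₂⌋₊ ⌊V * Real.log Q₂⌋₊) *
      (10 * max C₉ 0 * (3 * D * L ^ (1 - 6 * A)) ^ 2 * Real.log (2 * (((⌊T⌋₊ : ℕ) : ℝ) + 1)))) ≤
      720 * max C₉ 0 * D ^ 2 * (1 / V) := by
    rw [hsrpow]
    exact E2_factor_numerics33 hL1 hA2 hδ (le_max_right C₉ 0) rfl rfl rfl hPQ₂ hT'1 hlog2T'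
  have hK0 : 0 ≤ 10 * Q₁ * (((⌊T⌋₊ : ℕ) : ℝ) + 1) / Y + 72 := by positivity
  have hfin := final_numerics33 (le_max_right C₁₂ 0) (le_max_right C₉ 0) hs0.le hR0 hK0 h1 h5 h2 h3 h4
  have hRHS : max C₁₂ 0 * (2500 + 720 * max C₉ 0 * D ^ 2) * (Q₁ * T / Y + 1) * (1 / V) =
      Cf * (Q₁ * T / Y + 1) / L ^ (3 * A) := by
    rw [hCf, hVdef]; ring
  -- the main inequality at fixed `X`
  have key := prop51_fixed h12' h9' χ hY1 hT₀0 hTge hP₁1 hPQ₁ hP₂1 hPQ₂ hQP hV2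
    (by norm_num : (0 : ℝ) < 3 / 20) hUQ hN1 hcardB
  rw [filter_lichtmanTypicalWith]
  rw [← hRHS]
  exact key.trans hfin

end Literature.NumberTheory.Sieve.Lichtman2020
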